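import Summits.HodgeConjecture.HodgeConjecture.Theses.TropicalWeilObstruction

/-!
# Birth skeleton (BC3) — crux `TropicalWeilVanishing` of route `TropicalWeilObstruction`

Crux item `stmt-HodgeConjecture-18478`, decl
`Summit.HodgeConjecture.HodgeConjecture.Theses.TropicalWeilObstruction.TropicalWeilVanishing`:
for every positive definite real `8 × 8` matrix `Q` commuting with `J = weilJ 4` whose `16` free
entries are algebraically independent over `ℚ` (`IsWeilGeneric 4 Q`), every effective tropical
`4`-cycle `Z : TropicalTorusCycle 8 4 Q` on `ℝ⁸ / Q·ℤ⁸` has Weil functional `weilFunctional Z = 0`.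

## The seam (the route header's TWO-LAYER PLAN for K1, typed; registered decomposition of the item)

Split the cycles `Z` at a Weil period `Q` by their CLASS `cyc Z ∈ ⋀⁴ℝ⁸ ⊗ ⋀⁴ℤ⁸` (Plücker coordinates):
either `cyc Z` is a real multiple of the theta class `θ₄(Q) = Σ_I Qe_I ⊗ e_I`
(`thetaClass Q S S' = det Q[S, S']`), or it is not.

* `stub_rung_thetaMultiples` — THE RUNG (BC5 plan-only, size M): at EVERY Weil period (`Q ≻ 0`,
  `QJ = JQ`; no genericity) a cycle whose class is a theta multiple has `W = 0`. Mechanism: `W`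
  factors through `cyc` (`W = Ŵ ∘ cyc`, `Ŵ(x ⊗ y) = dz(x)·dz(y)`, Cauchy–Binet cell by cell), and
  `Ŵ(θ₄(Q)) = det(P Q Pᵀ)` with `P = [1 | i·1]` the `4 × 8` matrix of `dz₁ ∧ … ∧ dz₄`; for
  `Q = [[A, B], [-B, A]]` one computes `P Q Pᵀ = (A - iB) + i(B + iA) = 0`, so `Ŵ(θ₄(Q)) = 0`
  [Zharkov2020TropicalWeil §2, "`W(θ) = 0`"; MikhalkinZharkov2014Eigenwave Prop. 4.3].
* `stub_genericSpread` — GENERIC SPREAD (size M/L, true unconditionally): a cycle with NON-theta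
  class at a Weil-GENERIC `Q` spreads to an open set: there is an open `O ∋ Q` of matrices such that
  every Weil period `Q' ∈ O` carries an effective tropical `4`-cycle with non-theta class.
  Mechanism: fix the combinatorial type of `Z` (weights, frames, facet classes/perms/shifts — the
  discrete data); its realisations at `Q'` are the solutions `x = (vertices, edgeCoeffs, refFacets)`
  of a LINEAR system `M x = N q'` with rational `M, N` (`vertex_succ_sub`, `facet_eq`) inside the
  open set `{det T_σ > 0}`; solvability `N q' ∈ range M` is a finite set of affine `ℚ`-linear
  conditions on the free entries `q'`, satisfied at the algebraically independent `q`, hence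
  identically; `x(q') := M⁺N q' + (x₀ - M⁺N q)` is a continuous family of realisations through
  `Z`, and "class not a theta multiple" is an open condition near `(cyc Z, Q)` (`θ₄(Q') ≠ 0`).
  [Zharkov2020TropicalWeil pp. 2–4 (very general parameter); MikhalkinZharkov2014Eigenwave Def. 4.2]
* `stub_noOpenNonThetaLocus` — THE BET (size XL; Kontsevich's realisation-locus count): there is
  NO open set of matrices meeting the Weil period domain all of whose Weil periods carry an
  effective tropical `4`-cycle with non-theta class (non-theta effective `4`-cycles live over a
  countable union of proper closed subsets of the `16`-dimensional Weil period domain).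
  [Zharkov2020TropicalWeil pp. 2–4; the archive's eightfold dichotomy, alternative (ii)]

Stub statements are written with fully qualified `Literature.AlgebraicGeometry.Tropical.*` names
(verbatim the signatures first registered on the item by the route's typing seat, 2026-08-17T16:48Z;
`thetaClass` is the local definition below). `TropicalWeilVanishing_of` is the real (sorry-free) composition: given generic `Q` and `Z`,
`by_cases` on "`cyc Z` is a theta multiple": yes ⇒ stub 1; no ⇒ stub 2 yields an open `O ∋ Q`
of the kind stub 3 forbids — contradiction.

No stub alone gives the crux (stub 1 says nothing about non-theta classes; stub 2 PRODUCES
non-theta cycles; stub 3 says nothing about `W`) nor `HodgeConjecture` / `¬ HodgeConjecture`;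
BC3 probes (`stub → TropicalWeilVanishing`, `stub → HodgeConjecture`, `stub → ¬ HodgeConjecture`
by `first | exact? | simpa [·] | (unfold ·; simpa) | aesop`) are run in the sibling probe file
`bc/TropicalWeilVanishing_probes.lean` and all fail (see the seat's NOTES.md).
Disproof used: none (no `Disproof.lean` on this crux yet). Dead lines: none recorded.
-/

namespace Summit.HodgeConjecture.HodgeConjecture.Cruxes.TropicalWeilVanishing.Birth

open Summit.HodgeConjecture.HodgeConjecture.Theses.TropicalWeilObstruction

noncomputable section

/-- The **tropical theta class** `θ₄(Q) = Σ_I Qe_I ⊗ e_I ∈ ⋀⁴ℝ⁸ ⊗ ⋀⁴ℤ⁸` of the principally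
polarised tropical torus `ℝ⁸ / Q·ℤ⁸`, in the Plücker coordinates of `TropicalTorusCycle.cyc`:
`θ₄(Q)(S, S') = det (Q_{S(a), S'(b)})_{a,b}` (alternating in `S` and in `S'`, like `cyc`).
[cite: MikhalkinZharkov2014Eigenwave, §5.1 and Thm. 5.4] [cite: Zharkov2020TropicalWeil, §2] -/
def thetaClass (Q : Matrix (Fin (2 * 4)) (Fin (2 * 4)) ℝ) :
    (Fin 4 → Fin (2 * 4)) → (Fin 4 → Fin (2 * 4)) → ℝ :=
  fun S S' => (Q.submatrix S S').det

/-- **Stub 1 — the rung (BC5, plan-only): theta multiples have vanishing Weil functional at every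
Weil period.** For `Q ≻ 0` with `QJ = JQ` and every effective tropical `4`-cycle `Z` on `ℝ⁸/Q·ℤ⁸`
whose class is a real multiple of `θ₄(Q)`, `W(Z) = 0`. (`W = Ŵ ∘ cyc` by Cauchy–Binet and
`Ŵ(θ₄(Q)) = det(P Q Pᵀ) = 0`, `P = [1 | i·1]`.) [cite: Zharkov2020TropicalWeil, §2 (pp. 2–4)]
[cite: MikhalkinZharkov2014Eigenwave, Prop. 4.3] -/
theorem stub_rung_thetaMultiples :
    ∀ Q : Matrix (Fin (2 * 4)) (Fin (2 * 4)) ℝ, Q.PosDef → Q * Literature.AlgebraicGeometry.Tropical.weilJ 4 = Literature.AlgebraicGeometry.Tropical.weilJ 4 * Q →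
      ∀ Z : Literature.AlgebraicGeometry.Tropical.TropicalTorusCycle (2 * 4) 4 Q, (∃ r : ℝ, Z.cyc = r • thetaClass Q) →
        Literature.AlgebraicGeometry.Tropical.weilFunctional Z = 0 := by
  sorry

/-- **Stub 2 — generic spread.** At a Weil-generic period `Q`, an effective tropical `4`-cycle whose
class is NOT a theta multiple spreads: some open set `O ∋ Q` of matrices has, over each of its Weil
periods `Q'` (`Q' ≻ 0`, `Q'J = JQ'`), an effective tropical `4`-cycle with non-theta class (same
combinatorial type, realisation moved continuously; solvability of the rational linear realisation
system is forced at all parameters by the algebraic independence of the free entries of `Q`).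
[cite: Zharkov2020TropicalWeil, §2 (pp. 2–4)] [cite: MikhalkinZharkov2014Eigenwave, Def. 4.2] -/
theorem stub_genericSpread :
    ∀ Q : Matrix (Fin (2 * 4)) (Fin (2 * 4)) ℝ, Q.PosDef → Q * Literature.AlgebraicGeometry.Tropical.weilJ 4 = Literature.AlgebraicGeometry.Tropical.weilJ 4 * Q →
      Literature.AlgebraicGeometry.Tropical.IsWeilGeneric 4 Q →
      ∀ Z : Literature.AlgebraicGeometry.Tropical.TropicalTorusCycle (2 * 4) 4 Q, (¬ ∃ r : ℝ, Z.cyc = r • thetaClass Q) →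
        ∃ O : Set (Matrix (Fin (2 * 4)) (Fin (2 * 4)) ℝ), IsOpen O ∧ Q ∈ O ∧
          ∀ Q' ∈ O, Q'.PosDef → Q' * Literature.AlgebraicGeometry.Tropical.weilJ 4 = Literature.AlgebraicGeometry.Tropical.weilJ 4 * Q' →
            ∃ Z' : Literature.AlgebraicGeometry.Tropical.TropicalTorusCycle (2 * 4) 4 Q', ¬ ∃ r : ℝ, Z'.cyc = r • thetaClass Q' := by
  sorry

/-- **Stub 3 — the bet: no open non-theta locus.** There is no open set of real `8 × 8` matrices
meeting the Weil period domain (`Q ≻ 0`, `QJ = JQ`) such that every Weil period in it carries an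
effective tropical `4`-cycle whose class is not a theta multiple (Kontsevich's count: non-theta
effective tropical `4`-cycles are realised only over a countable union of proper closed subsets of
the Weil period domain). [cite: Zharkov2020TropicalWeil, §1–2 (pp. 2–4)] -/
theorem stub_noOpenNonThetaLocus :
    ¬ ∃ O : Set (Matrix (Fin (2 * 4)) (Fin (2 * 4)) ℝ), IsOpen O ∧
      (∃ Q ∈ O, Q.PosDef ∧ Q * Literature.AlgebraicGeometry.Tropical.weilJ 4 = Literature.AlgebraicGeometry.Tropical.weilJ 4 * Q) ∧
      ∀ Q' ∈ O, Q'.PosDef → Q' * Literature.AlgebraicGeometry.Tropical.weilJ 4 = Literature.AlgebraicGeometry.Tropical.weilJ 4 * Q' →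
        ∃ Z' : Literature.AlgebraicGeometry.Tropical.TropicalTorusCycle (2 * 4) 4 Q', ¬ ∃ r : ℝ, Z'.cyc = r • thetaClass Q' := by
  sorry

/-! ## Name-keyed aliases of the three statements — the hypotheses of `TropicalWeilVanishing_of`
The skeleton audit (`#h21_check_skeleton`) admits a hypothesis of the skeleton theorem only if its head constant is
a registered obligation or is NAMED like a declared stub; `__Registered.stub_X` is the statement of `stub_X` verbatim
under the stub's short name (device of `Cruxes/AlgebraicDensity/Lines/birth.lean`; the `__` namespace is an
implementation detail, so the audit's stub report resolves each `stub_…` to the sorried theorem above). The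
corollary `TropicalWeilVanishing_of_stubs` checks by `rfl`-unfolding that each alias IS its stub's statement. -/
namespace __Registered

/-- Statement of `stub_rung_thetaMultiples`, keyed by the registered stub name. -/
abbrev stub_rung_thetaMultiples : Prop :=
  ∀ Q : Matrix (Fin (2 * 4)) (Fin (2 * 4)) ℝ, Q.PosDef → Q * Literature.AlgebraicGeometry.Tropical.weilJ 4 = Literature.AlgebraicGeometry.Tropical.weilJ 4 * Q →
    ∀ Z : Literature.AlgebraicGeometry.Tropical.TropicalTorusCycle (2 * 4) 4 Q, (∃ r : ℝ, Z.cyc = r • thetaClass Q) →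
      Literature.AlgebraicGeometry.Tropical.weilFunctional Z = 0

/-- Statement of `stub_genericSpread`, keyed by the registered stub name. -/
abbrev stub_genericSpread : Prop :=
  ∀ Q : Matrix (Fin (2 * 4)) (Fin (2 * 4)) ℝ, Q.PosDef → Q * Literature.AlgebraicGeometry.Tropical.weilJ 4 = Literature.AlgebraicGeometry.Tropical.weilJ 4 * Q →
    Literature.AlgebraicGeometry.Tropical.IsWeilGeneric 4 Q →
    ∀ Z : Literature.AlgebraicGeometry.Tropical.TropicalTorusCycle (2 * 4) 4 Q, (¬ ∃ r : ℝ, Z.cyc = r • thetaClass Q) →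
      ∃ O : Set (Matrix (Fin (2 * 4)) (Fin (2 * 4)) ℝ), IsOpen O ∧ Q ∈ O ∧
        ∀ Q' ∈ O, Q'.PosDef → Q' * Literature.AlgebraicGeometry.Tropical.weilJ 4 = Literature.AlgebraicGeometry.Tropical.weilJ 4 * Q' →
          ∃ Z' : Literature.AlgebraicGeometry.Tropical.TropicalTorusCycle (2 * 4) 4 Q', ¬ ∃ r : ℝ, Z'.cyc = r • thetaClass Q'

/-- Statement of `stub_noOpenNonThetaLocus`, keyed by the registered stub name. -/
abbrev stub_noOpenNonThetaLocus : Prop :=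
  ¬ ∃ O : Set (Matrix (Fin (2 * 4)) (Fin (2 * 4)) ℝ), IsOpen O ∧
    (∃ Q ∈ O, Q.PosDef ∧ Q * Literature.AlgebraicGeometry.Tropical.weilJ 4 = Literature.AlgebraicGeometry.Tropical.weilJ 4 * Q) ∧
    ∀ Q' ∈ O, Q'.PosDef → Q' * Literature.AlgebraicGeometry.Tropical.weilJ 4 = Literature.AlgebraicGeometry.Tropical.weilJ 4 * Q' →
      ∃ Z' : Literature.AlgebraicGeometry.Tropical.TropicalTorusCycle (2 * 4) 4 Q', ¬ ∃ r : ℝ, Z'.cyc = r • thetaClass Q'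

end __Registered

/-- **Composition (real proof) — THE SKELETON THEOREM.** Given a generic Weil period `Q` and an
effective tropical `4`-cycle `Z`: if `cyc Z ∈ ℝ·θ₄(Q)` then `W(Z) = 0` by the rung (stub 1);
otherwise generic spread (stub 2) produces an open set `O ∋ Q` all of whose Weil periods carry a
non-theta effective `4`-cycle, which stub 3 forbids. Hypotheses = the three stub statements
(name-keyed aliases); concludes the route decl `TropicalWeilVanishing` BY NAME. -/
theorem TropicalWeilVanishing_of :
    __Registered.stub_rung_thetaMultiples → __Registered.stub_genericSpread →
      __Registered.stub_noOpenNonThetaLocus → TropicalWeilVanishing := by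
  intro h₁ h₂ h₃ Q hQ hJ hgen Z
  by_cases hθ : ∃ r : ℝ, Z.cyc = r • thetaClass Q
  · exact h₁ Q hQ hJ Z hθ
  · obtain ⟨O, hO, hQO, hall⟩ := h₂ Q hQ hJ hgen Z hθ
    exact absurd ⟨O, hO, ⟨Q, hQO, hQ, hJ⟩, hall⟩ h₃

/-- **The crux, closed modulo exactly the three registered stubs** (sanity: the stubs compose, and
each alias is its stub's statement). -/
theorem TropicalWeilVanishing_of_stubs : TropicalWeilVanishing :=
  TropicalWeilVanishing_of stub_rung_thetaMultiples stub_genericSpread stub_noOpenNonThetaLocus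

end

end Summit.HodgeConjecture.HodgeConjecture.Cruxes.TropicalWeilVanishing.Birth
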